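/-
Width seat `ym-line-cbag-p1-w2` (prover-ym-line-cbag-p1-w2-g2-0; own items 22254/22893 closed), route `ColdBoxAllGroups`, helping crux
`BulkAllGroups` (stmt-QuantumFields-22255), line `dlr-chessboard-G` (lead `ym-line-cbag-p2`): the KERNEL BRIDGE, any compact gauge group —
G-port of `…BulkDominatesColdBoxWKernelBridge` on top of the lead's H-A1-G `…BulkAllGroupsKernelTransportG`.
-/
import Summits.QuantumFields.YangMills.Theorems.ColdBoxAllGroupsBulkAllGroupsKernelTransportG
import Summits.QuantumFields.YangMills.Theorems.WeakCouplingRatesColdBoxForestGauge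

/-!
# Crux `BulkAllGroups` (stmt-QuantumFields-22255), expansion stubs N2-cov-G / N2-mean-G: the kernel bridge
# `γ(·|ω) = γ(·|W)` for gauge-invariant observables local to the enlarged box, `W = forestFix H (truncated gauge copy of ω)` — any compact `G`

G-port of T5 of the `SU(2)` line (`WeakCouplingRates.integral_boxKernel_eq_of_gauge_trunc`, module `…BulkDominatesColdBoxWKernelBridge`), in the
same shape so that the assembler's `_explicit` theorems instantiate it by `exact`: for a continuous `ρ`, every measurable gauge-invariant
`X : LGConfig 4 G → ℝ` with `X U = X U'` whenever `U = U'` on `E = boxEdgesAt dirCorner (2H+3)` satisfies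
  `∫ X d(boxKernelG ρ β H ω) = ∫ X d(boxKernelG ρ β H (forestFix H (glueWith E ((ω^g)|_E) 1)))`.
Steps: the temporal-forest gauge fixing of the datum is a gauge transformation of the datum (`forestFix H V = V^{forestGauge H V}`, G-free tree
definition), so the G-generic gauge covariance of the kernel `integral_ymSpecification_gaugeTransformZd` removes it
(`integral_boxKernelG_forestFix_eq`); then the lead's weak-locality transport `integral_boxKernelG_eq_trunc_gauge_of_enlarged` (H-A1-G).  Also the
event form (`measureReal_boxKernelG_eq_of_gauge_trunc`) and the collar large-field event (`measureReal_largeField_boxKernelG_eq_of_gauge_trunc`), so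
that B5-G `boxKernelG_largeField_rarity_crudeGood` / `boxKernelG_real_coldGoodSetG_compl_le` (stated at the crude-good `ω`) apply to the charted
configuration `W` of the datum package.  No new definition; no sorry; standard axioms.  NOT a claim about the mass gap: the crux is a rung-level
statement (R2xi-G `XiPow`, RECORD label); the Yang–Mills mass gap is NOT proved by any of this.
-/

set_option autoImplicit false

noncomputable section

open MeasureTheory Finset
open Literature.Probability.LatticeModels Literature.MathematicalPhysics.QuantumLattice
open Literature.MathematicalPhysics.QuantumFieldTheory Literature.MathematicalPhysics.QuantumFieldTheory.AxialGauge
open Literature.MathematicalPhysics.QuantumFieldTheory.LatticeMaxwell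
open Summit.QuantumFields.YangMills.Theorems.WeakCouplingRates

namespace Summit.QuantumFields.YangMills.Theorems.ColdBoxAllGroups

variable {N : ℕ} {G : Type*} [Group G] [TopologicalSpace G] [IsTopologicalGroup G] [CompactSpace G]
  [MeasurableSpace G] [BorelSpace G] [SecondCountableTopology G]
variable (ρ : G →* Matrix (Fin N) (Fin N) ℂ) (hρc : Continuous ρ)

omit [Group G] [TopologicalSpace G] [IsTopologicalGroup G] [CompactSpace G] [MeasurableSpace G] [BorelSpace G]
  [SecondCountableTopology G] in
/-- Locality on the enlarged box in the `U = U' on E` form implies the glued (weak-locality) form used by H-A1-G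
`integral_boxKernelG_eq_trunc_gauge_of_enlarged`. [folklore] -/
theorem glueWith_loc_of_enlarged_locG {H : ℕ} {X : LGConfig 4 G → ℝ}
    (hXloc : ∀ U U' : LGConfig 4 G, (∀ e ∈ boxEdgesAt dirCorner (2 * H + 3), U e = U' e) → X U = X U')
    (ζ : ↥(boxEdges 4 (2 * H + 1)) → G) (η η' : LGConfig 4 G)
    (hη : ∀ e ∈ boxEdgesAt dirCorner (2 * H + 3), η e = η' e) :
    X (glueWith (boxEdges 4 (2 * H + 1)) ζ η) = X (glueWith (boxEdges 4 (2 * H + 1)) ζ η') := by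
  refine hXloc _ _ fun e he => ?_
  by_cases heΛ : e ∈ boxEdges 4 (2 * H + 1)
  · rw [glueWith_apply_mem _ _ _ heΛ, glueWith_apply_mem _ _ _ heΛ]
  · rw [glueWith_apply_not_mem _ _ _ heΛ, glueWith_apply_not_mem _ _ _ heΛ, hη e he]

include hρc

/-- **The temporal-forest gauge fixing of the datum does not change kernel means of gauge-invariant observables**, any compact `G`:
`∫ X d(boxKernelG ρ β H (forestFix H V)) = ∫ X d(boxKernelG ρ β H V)` (`forestFix H V = V^{forestGauge H V}` and the kernel is gauge covariant). -/
theorem integral_boxKernelG_forestFix_eq (β : ℝ) (H : ℕ) (V : LGConfig 4 G)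
    {X : LGConfig 4 G → ℝ} (hXm : Measurable X) (hXinv : IsZdGaugeInvariant X) :
    ∫ U, X U ∂(boxKernelG ρ β H (forestFix H V)) = ∫ U, X U ∂(boxKernelG ρ β H V) := by
  unfold boxKernelG forestFix
  exact integral_ymSpecification_gaugeTransformZd ρ hρc β _ hXm hXinv (forestGauge H V) V

/-- **The kernel bridge, any compact `G`** (G-port of T5 `integral_boxKernel_eq_of_gauge_trunc`, same shape): kernel means of measurable
gauge-invariant observables local to the enlarged box `E = boxEdgesAt dirCorner (2H+3)` are the same at the datum `ω` and at the
forest-fixed truncated gauge copy `W = forestFix H (glueWith E ((ω^g)|_E) 1)`, for every gauge `g`. -/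
theorem integral_boxKernelG_eq_of_gauge_trunc (β : ℝ) (H : ℕ) (ω : LGConfig 4 G) (g : Site 4 → G)
    {X : LGConfig 4 G → ℝ} (hXm : Measurable X) (hXinv : IsZdGaugeInvariant X)
    (hXloc : ∀ U U' : LGConfig 4 G, (∀ e ∈ boxEdgesAt dirCorner (2 * H + 3), U e = U' e) → X U = X U') :
    ∫ U, X U ∂(boxKernelG ρ β H ω) =
      ∫ U, X U ∂(boxKernelG ρ β H
        (forestFix H (glueWith (boxEdgesAt dirCorner (2 * H + 3))
          (fun e' : ↥(boxEdgesAt dirCorner (2 * H + 3)) => gaugeTransformZd g ω e'.1) (fun _ => 1)))) := by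
  rw [integral_boxKernelG_forestFix_eq ρ hρc β H _ hXm hXinv]
  exact integral_boxKernelG_eq_trunc_gauge_of_enlarged ρ hρc β H ω g hXm hXinv
    (fun ζ η η' hη => glueWith_loc_of_enlarged_locG hXloc ζ η η' hη)

/-- **The kernel bridge under weak locality**: the same, when `X (glueWith Λ ζ η)` depends on `η` only through its links in the enlarged box
(the hypothesis shape of H-A1-G `integral_boxKernelG_eq_trunc_gauge_of_enlarged`). -/
theorem integral_boxKernelG_eq_of_gauge_trunc_of_enlarged (β : ℝ) (H : ℕ) (ω : LGConfig 4 G) (g : Site 4 → G)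
    {X : LGConfig 4 G → ℝ} (hXm : Measurable X) (hXinv : IsZdGaugeInvariant X)
    (hXloc : ∀ (ζ : ↥(boxEdges 4 (2 * H + 1)) → G) (η η' : LGConfig 4 G),
      (∀ e ∈ boxEdgesAt dirCorner (2 * H + 3), η e = η' e) →
        X (glueWith (boxEdges 4 (2 * H + 1)) ζ η) = X (glueWith (boxEdges 4 (2 * H + 1)) ζ η')) :
    ∫ U, X U ∂(boxKernelG ρ β H ω) =
      ∫ U, X U ∂(boxKernelG ρ β H
        (forestFix H (glueWith (boxEdgesAt dirCorner (2 * H + 3))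
          (fun e' : ↥(boxEdgesAt dirCorner (2 * H + 3)) => gaugeTransformZd g ω e'.1) (fun _ => 1)))) := by
  rw [integral_boxKernelG_forestFix_eq ρ hρc β H _ hXm hXinv]
  exact integral_boxKernelG_eq_trunc_gauge_of_enlarged ρ hρc β H ω g hXm hXinv hXloc

/-- **Kernel means of one plaquette cost under the bridge**: for a plaquette whose four edges are box edges,
`E_{γ(·|ω)}[c_p] = E_{γ(·|W)}[c_p]`, `W` the forest-fixed truncated gauge copy. -/
theorem integral_plaqCostAt_boxKernelG_eq_of_gauge_trunc (β : ℝ) (H : ℕ) (ω : LGConfig 4 G) (g : Site 4 → G)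
    {x : Site 4} {i j : Fin 4}
    (h1 : (x, i) ∈ boxEdges 4 (2 * H + 1)) (h2 : (x + Pi.single i 1, j) ∈ boxEdges 4 (2 * H + 1))
    (h3 : (x + Pi.single j 1, i) ∈ boxEdges 4 (2 * H + 1)) (h4 : (x, j) ∈ boxEdges 4 (2 * H + 1)) :
    ∫ U, plaqCostAt ρ x i j U ∂(boxKernelG ρ β H ω) =
      ∫ U, plaqCostAt ρ x i j U ∂(boxKernelG ρ β H
        (forestFix H (glueWith (boxEdgesAt dirCorner (2 * H + 3))
          (fun e' : ↥(boxEdgesAt dirCorner (2 * H + 3)) => gaugeTransformZd g ω e'.1) (fun _ => 1)))) := by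
  rw [integral_plaqCostAt_boxKernelG_eq_trunc_gauge ρ hρc β H ω g h1 h2 h3 h4,
    ← integral_boxKernelG_forestFix_eq ρ hρc β H _ (measurable_plaqCostAtG ρ hρc x i j) (isZdGaugeInvariant_plaqCostAt ρ x i j)]

/-- **Kernel means of a product of two plaquette costs under the bridge** (both plaquettes with all four edges in the box). -/
theorem integral_plaqCostAt_mul_boxKernelG_eq_of_gauge_trunc (β : ℝ) (H : ℕ) (ω : LGConfig 4 G) (g : Site 4 → G)
    {x : Site 4} {i j : Fin 4} {x' : Site 4} {i' j' : Fin 4}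
    (h1 : (x, i) ∈ boxEdges 4 (2 * H + 1)) (h2 : (x + Pi.single i 1, j) ∈ boxEdges 4 (2 * H + 1))
    (h3 : (x + Pi.single j 1, i) ∈ boxEdges 4 (2 * H + 1)) (h4 : (x, j) ∈ boxEdges 4 (2 * H + 1))
    (h1' : (x', i') ∈ boxEdges 4 (2 * H + 1)) (h2' : (x' + Pi.single i' 1, j') ∈ boxEdges 4 (2 * H + 1))
    (h3' : (x' + Pi.single j' 1, i') ∈ boxEdges 4 (2 * H + 1)) (h4' : (x', j') ∈ boxEdges 4 (2 * H + 1)) :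
    ∫ U, plaqCostAt ρ x i j U * plaqCostAt ρ x' i' j' U ∂(boxKernelG ρ β H ω) =
      ∫ U, plaqCostAt ρ x i j U * plaqCostAt ρ x' i' j' U ∂(boxKernelG ρ β H
        (forestFix H (glueWith (boxEdgesAt dirCorner (2 * H + 3))
          (fun e' : ↥(boxEdgesAt dirCorner (2 * H + 3)) => gaugeTransformZd g ω e'.1) (fun _ => 1)))) := by
  rw [integral_plaqCostAt_mul_boxKernelG_eq_trunc_gauge ρ hρc β H ω g h1 h2 h3 h4 h1' h2' h3' h4']
  exact (integral_boxKernelG_forestFix_eq ρ hρc β H _ (X := fun U => plaqCostAt ρ x i j U * plaqCostAt ρ x' i' j' U)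
    ((measurable_plaqCostAtG ρ hρc x i j).mul (measurable_plaqCostAtG ρ hρc x' i' j'))
    (isZdGaugeInvariant_plaqCostAt_mul _ x x' i j i' j')).symm

/-- **Near-centre plaquette mean under the bridge** (base point within `H/8` of the centre, `H ≥ 1`, `i ≠ j`). -/
theorem integral_plaqCostAt_boxKernelG_eq_of_gauge_trunc_of_near_centre (β : ℝ) {H : ℕ} (hH : 1 ≤ H) (ω : LGConfig 4 G)
    (g : Site 4 → G) {x : Site 4} (hx : ∀ m : Fin 4, 8 * |x m - (H : ℤ)| ≤ (H : ℤ)) {i j : Fin 4} (hij : i ≠ j) :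
    ∫ U, plaqCostAt ρ x i j U ∂(boxKernelG ρ β H ω) =
      ∫ U, plaqCostAt ρ x i j U ∂(boxKernelG ρ β H
        (forestFix H (glueWith (boxEdgesAt dirCorner (2 * H + 3))
          (fun e' : ↥(boxEdgesAt dirCorner (2 * H + 3)) => gaugeTransformZd g ω e'.1) (fun _ => 1)))) := by
  obtain ⟨h1, h2, h3, h4⟩ := near_centre_plaquette_edges_mem hH hx hij
  exact integral_plaqCostAt_boxKernelG_eq_of_gauge_trunc ρ hρc β H ω g h1 h2 h3 h4

/-- **Near-centre two-point integral under the bridge.** -/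
theorem integral_plaqCostAt_mul_boxKernelG_eq_of_gauge_trunc_of_near_centre (β : ℝ) {H : ℕ} (hH : 1 ≤ H) (ω : LGConfig 4 G)
    (g : Site 4 → G) {x y : Site 4} (hx : ∀ m : Fin 4, 8 * |x m - (H : ℤ)| ≤ (H : ℤ))
    (hy : ∀ m : Fin 4, 8 * |y m - (H : ℤ)| ≤ (H : ℤ)) {i j k l : Fin 4} (hij : i ≠ j) (hkl : k ≠ l) :
    ∫ U, plaqCostAt ρ x i j U * plaqCostAt ρ y k l U ∂(boxKernelG ρ β H ω) =
      ∫ U, plaqCostAt ρ x i j U * plaqCostAt ρ y k l U ∂(boxKernelG ρ β H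
        (forestFix H (glueWith (boxEdgesAt dirCorner (2 * H + 3))
          (fun e' : ↥(boxEdgesAt dirCorner (2 * H + 3)) => gaugeTransformZd g ω e'.1) (fun _ => 1)))) := by
  obtain ⟨h1, h2, h3, h4⟩ := near_centre_plaquette_edges_mem hH hx hij
  obtain ⟨h1', h2', h3', h4'⟩ := near_centre_plaquette_edges_mem hH hy hkl
  exact integral_plaqCostAt_mul_boxKernelG_eq_of_gauge_trunc ρ hρc β H ω g h1 h2 h3 h4 h1' h2' h3' h4'

/-- **The bridge, event form**: probabilities of measurable gauge-invariant events local to the enlarged box. -/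
theorem measureReal_boxKernelG_eq_of_gauge_trunc (β : ℝ) (H : ℕ) (ω : LGConfig 4 G) (g : Site 4 → G)
    {s : Set (LGConfig 4 G)} (hs : MeasurableSet s) (hsinv : ∀ (g' : Site 4 → G) U, gaugeTransformZd g' U ∈ s ↔ U ∈ s)
    (hsloc : ∀ U U' : LGConfig 4 G, (∀ e ∈ boxEdgesAt dirCorner (2 * H + 3), U e = U' e) → (U ∈ s ↔ U' ∈ s)) :
    (boxKernelG ρ β H ω).real s =
      (boxKernelG ρ β H
        (forestFix H (glueWith (boxEdgesAt dirCorner (2 * H + 3))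
          (fun e' : ↥(boxEdgesAt dirCorner (2 * H + 3)) => gaugeTransformZd g ω e'.1) (fun _ => 1)))).real s := by
  rw [← integral_indicator_one hs, ← integral_indicator_one hs]
  refine integral_boxKernelG_eq_of_gauge_trunc ρ hρc β H ω g (measurable_const.indicator hs) ?_ ?_
  · intro g' U
    by_cases hU : U ∈ s
    · rw [Set.indicator_of_mem hU, Set.indicator_of_mem ((hsinv g' U).2 hU)]; rfl
    · rw [Set.indicator_of_notMem hU, Set.indicator_of_notMem (fun h => hU ((hsinv g' U).1 h))]
  · intro U U' hUU'
    by_cases hU : U ∈ s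
    · rw [Set.indicator_of_mem hU, Set.indicator_of_mem ((hsloc U U' hUU').1 hU)]; rfl
    · rw [Set.indicator_of_notMem hU, Set.indicator_of_notMem (fun h => hU ((hsloc U U' hUU').2 h))]

/-- **The collar large-field event under the bridge**: same kernel probability at `ω` and at the forest-fixed truncated gauge copy `W`, so the
YM-side rarity B5-G `boxKernelG_largeField_rarity_crudeGood` (stated at crude-good `ω`) transfers to the charted configuration `W`. -/
theorem measureReal_largeField_boxKernelG_eq_of_gauge_trunc (β s : ℝ) (H : ℕ) (ω : LGConfig 4 G) (g : Site 4 → G) :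
    (boxKernelG ρ β H ω).real {U | ∃ p ∈ plaquettesTouching (boxEdges 4 (2 * H + 1)),
        s ≤ (N : ℝ) - plaquetteObs ρ p.1 p.2.1.1 p.2.1.2 U} =
      (boxKernelG ρ β H
        (forestFix H (glueWith (boxEdgesAt dirCorner (2 * H + 3))
          (fun e' : ↥(boxEdgesAt dirCorner (2 * H + 3)) => gaugeTransformZd g ω e'.1) (fun _ => 1)))).real
        {U | ∃ p ∈ plaquettesTouching (boxEdges 4 (2 * H + 1)),
          s ≤ (N : ℝ) - plaquetteObs ρ p.1 p.2.1.1 p.2.1.2 U} := by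
  set S : Set (LGConfig 4 G) := {U | ∃ p ∈ plaquettesTouching (boxEdges 4 (2 * H + 1)),
      s ≤ (N : ℝ) - plaquetteObs ρ p.1 p.2.1.1 p.2.1.2 U} with hSdef
  have hS : MeasurableSet S := measurableSet_exists_plaqCost_ge_of_rep ρ hρc _ s
  have hinv : IsZdGaugeInvariant (S.indicator (1 : LGConfig 4 G → ℝ)) := by
    intro g' U
    have hiff : gaugeTransformZd g' U ∈ S ↔ U ∈ S := by
      simp only [hSdef, Set.mem_setOf_eq, isZdGaugeInvariant_plaquetteObs ρ _ _ _ g' U]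
    by_cases hU : U ∈ S
    · rw [Set.indicator_of_mem hU, Set.indicator_of_mem (hiff.2 hU)]; rfl
    · rw [Set.indicator_of_notMem hU, Set.indicator_of_notMem (fun h => hU (hiff.1 h))]
  rw [measureReal_largeField_boxKernelG_eq_trunc_gauge ρ hρc β s H ω g, ← integral_indicator_one hS, ← integral_indicator_one hS]
  exact (integral_boxKernelG_forestFix_eq ρ hρc β H _ (X := S.indicator 1) (measurable_one.indicator hS) hinv).symm

end Summit.QuantumFields.YangMills.Theorems.ColdBoxAllGroups

end
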